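import Mathlib
import Literature.NumberTheory.LFunctions.Zhang2022.Section7cStatements
import Literature.NumberTheory.LFunctions.Zhang2022.Section7bStatements
import Literature.NumberTheory.LFunctions.Zhang2022.KappaLSeries
import Literature.NumberTheory.LFunctions.Zhang2022.Section3MeanValues
import Literature.NumberTheory.Sieve.MontgomeryVaughan1975GaussSums
import HarnessLib

/-!
# Zhang (2022), slice L2-t4 (§7, proof of Proposition 7.1, the error term): kernel discharges

Topic `Literature/NumberTheory/LFunctions/Zhang2022` (Landau–Siegel audit tree; verdict-neutral).
Companion of `Section7cStatements` (the typed CLAIMS `Z22:(7.12)`–`(7.15)`, `§7.u031`–`§7.u041` of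
Y. Zhang, arXiv:2211.02515v1, §7 pp. 37–39). This file only PROVES some of those claims; it declares
no new definition and no new named fact, and asserts nothing about Theorems 1–2 of the manuscript
or about Landau–Siegel zeros.

* `step7u031tau_holds : Step7u031tau` — `|τ(θ̄)| ≤ r^{1/2}` for a character `(mod hr)` induced by
  a primitive `θ* (mod r)` (Montgomery–Vaughan 1975, Lemmas 5.1–5.2, PROVED in the tree:
  `MontgomeryVaughan1975.norm_gaussSum_changeLevel_inv_le`).
* `step7u040_holds : Step7u040` — the large-sieve display of §7.u040,
  `Σ_{R≤r<2R} Σ*_{θ mod r} |Σ_{p∼P} θ̄(p)p^s|² ≤ 486 (R² + P)P³` (`σ = 1`, `R ≥ 1`, `D ≥ 3`), from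
  the tree's large sieve for primitive characters over arbitrary moduli sets
  (`Zhang2022.largeSieve_meanValue`, constant `N + 1 + 2Q²`).
* `eq715_of_truncI_u041 : Step7bTruncI c′ → Step7u041 c′ → Eq715 c′` and `ded715_holds : Ded715 c′`
  — the closing edge "This yields (7.15)": the `l ∉ 𝔌(Rh)` truncation and the Cauchy bound §7.u041
  give (7.15) (bookkeeping: `(2R+1)² ≤ 9R² ≤ 9P²` pairs `(r, θ)`, `exp(−c𝓛¹⁰) ≤ D^{−c}`).
* `Iface.frakT12_eq`, `Iface.eq711_iff` — the TODO-merge bridges of the interface stubs to the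
  owner's landed decls `Section7bStatements.frakT12` / `Section7bStatements.Eq711` (slice L2-t3):
  the stubs are EQUAL to the owner's objects (`MeanSquareMajorant.conv = LSeries.convolution`,
  the tree's `MeanSquareMajorant.conv_eq_convolution`; `gaussBar (k+1) θ = GammaFactor.tau θ⁻¹`).

## References

* Y. Zhang, arXiv:2211.02515v1 (2022), §7 pp. 37–39. [cite: Zhang2022LandauSiegel, §7 pp. 37–39]
* H. L. Montgomery, R. C. Vaughan, Acta Arith. 27 (1975), §5 Lemmas 5.1–5.2.
  [cite: MontgomeryVaughanActa1975, §5]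
-/

noncomputable section

open Complex Real MeasureTheory
open Literature.NumberTheory.LFunctions.Zhang2022

namespace Literature.NumberTheory.LFunctions.Zhang2022.Section7cStatements


/-- **`§7.u031` (prose) holds**: `|τ(θ̄)| ≤ r^{1/2}` for `θ (mod hr)` induced by a primitive
`θ* (mod r)` — the tree's `MontgomeryVaughan1975.norm_gaussSum_changeLevel_inv_le`
(`τ(χ) = μ(q/r)χ*(q/r)τ(χ*)`, `|τ(χ*)| = r^{1/2}`). [cite: MontgomeryVaughanActa1975, §5 Lemmas 5.1–5.2] -/
theorem step7u031tau_holds : Step7u031tau := by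
  intro h r θs hh hr hθ
  have hk : h * r ≠ 0 := Nat.mul_ne_zero (Nat.pos_iff_ne_zero.mp hh) (by omega)
  haveI : NeZero r := ⟨by omega⟩
  haveI : NeZero (h * r) := ⟨hk⟩
  have key :=
    Literature.NumberTheory.Sieve.MontgomeryVaughan1975.norm_gaussSum_changeLevel_inv_le
      (q := h * r) (Nat.dvd_mul_left r h) hθ
  simp only [gaussBar, dif_neg hk]
  refine le_trans key ?_
  split_ifs
  · rw [mul_one]
  · rw [mul_zero]; exact Real.sqrt_nonneg _

/-- `τ_{j+1}(d) ≥ 1` for `d ≥ 1` (there is at least the trivial factorisation). [folklore] -/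
private theorem one_le_tau_succ (j : ℕ) {d : ℕ} (hd : d ≠ 0) :
    1 ≤ MeanSquareMajorant.tau (j + 1) d := by
  induction j with
  | zero => rw [MeanSquareMajorant.tau_one_apply hd]
  | succ j ih =>
    rw [MeanSquareMajorant.tau_succ_apply]
    calc (1 : ℝ) ≤ MeanSquareMajorant.tau (j + 1) d := ih
      _ ≤ ∑ e ∈ d.divisors, MeanSquareMajorant.tau (j + 1) e :=
        Finset.single_le_sum (f := fun e => MeanSquareMajorant.tau (j + 1) e)
          (fun e _ => MeanSquareMajorant.tau_nonneg (j + 1) e) (Nat.mem_divisors_self d hd)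

/-- `τ₅(d) ≥ 1` for `d ≥ 1`. [folklore] -/
private theorem one_le_tau_five {d : ℕ} (hd : 0 < d) : 1 ≤ MeanSquareMajorant.tau 5 d :=
  one_le_tau_succ 4 (Nat.pos_iff_ne_zero.mp hd)

/-- Members of the dyadic block `R ≤ r < 2R` with `R ≥ 1` are positive and `< 2R`. [folklore] -/
private theorem mem_dyadic {R : ℝ} {r : ℕ} (hr : r ∈ dyadic R) :
    R ≤ (r : ℝ) ∧ (r : ℝ) < 2 * R := (Finset.mem_filter.mp hr).2

open scoped Classical in
/-- The number of characters to moduli `R ≤ r < 2R`, counted with weight `1` on the primitive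
ones, is at most `(2R+1)²` (`#{θ mod r} = φ(r) ≤ r < 2R`, at most `⌈2R⌉ ≤ 2R + 1` moduli).
[folklore] -/
private theorem sum_dyadic_card_le {R : ℝ} (hR : 1 ≤ R) :
    ∑ r ∈ dyadic R, ∑ θ : DirichletCharacter ℂ r, (if θ.IsPrimitive then (1 : ℝ) else 0) ≤
      (2 * R + 1) ^ 2 := by
  have h1 : ∀ r ∈ dyadic R,
      ∑ θ : DirichletCharacter ℂ r, (if θ.IsPrimitive then (1 : ℝ) else 0) ≤ 2 * R + 1 := by
    intro r hr
    obtain ⟨hRr, hr2⟩ := mem_dyadic hr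
    have hr1 : (1 : ℝ) ≤ r := le_trans hR hRr
    have hr0 : r ≠ 0 := by
      intro h; subst h; norm_num at hr1
    haveI : NeZero r := ⟨hr0⟩
    calc ∑ θ : DirichletCharacter ℂ r, (if θ.IsPrimitive then (1 : ℝ) else 0)
        ≤ ∑ _θ : DirichletCharacter ℂ r, (1 : ℝ) :=
          Finset.sum_le_sum fun θ _ => by split_ifs <;> norm_num
      _ = Fintype.card (DirichletCharacter ℂ r) := by simp
      _ = r.totient := by
          rw [← Nat.card_eq_fintype_card, DirichletCharacter.card_eq_totient_of_hasEnoughRootsOfUnity ℂ r]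
      _ ≤ r := by exact_mod_cast Nat.totient_le r
      _ ≤ 2 * R + 1 := by linarith
  have hcard : ((dyadic R).card : ℝ) ≤ 2 * R + 1 := by
    have : (dyadic R).card ≤ ⌈2 * R⌉₊ := by
      calc (dyadic R).card ≤ (Finset.range ⌈2 * R⌉₊).card := Finset.card_filter_le _ _
        _ = ⌈2 * R⌉₊ := Finset.card_range _
    calc ((dyadic R).card : ℝ) ≤ ⌈2 * R⌉₊ := by exact_mod_cast this
      _ ≤ 2 * R + 1 := (Nat.ceil_lt_add_one (by linarith)).le
  calc ∑ r ∈ dyadic R, ∑ θ : DirichletCharacter ℂ r, (if θ.IsPrimitive then (1 : ℝ) else 0)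
      ≤ ∑ _r ∈ dyadic R, (2 * R + 1) := Finset.sum_le_sum h1
    _ = (dyadic R).card * (2 * R + 1) := by rw [Finset.sum_const, nsmul_eq_mul]
    _ ≤ (2 * R + 1) * (2 * R + 1) := by
        apply mul_le_mul_of_nonneg_right hcard; linarith
    _ = (2 * R + 1) ^ 2 := by ring

/-- `log D ≥ 1` once `D ≥ 3`. [folklore] -/
private theorem one_le_ell {D : ℕ} (hD : 3 ≤ D) : 1 ≤ Skeleton.ell D := by
  have hD' : (3 : ℝ) ≤ D := by exact_mod_cast hD
  rw [Skeleton.ell, Real.le_log_iff_exp_le (by linarith)]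
  exact le_trans (le_of_lt (lt_trans Real.exp_one_lt_d9 (by norm_num))) hD'

/-- `P = exp(𝓛⁹) ≥ 1`. [folklore] -/
private theorem one_le_bigP (D : ℕ) : 1 ≤ Skeleton.bigP D :=
  Real.one_le_exp (by rw [Skeleton.ell]; positivity)

/-- `P₁ = P^{0.504} ≤ P`. [folklore] -/
private theorem P1_le_bigP (D : ℕ) : Skeleton.P1 D ≤ Skeleton.bigP D := by
  have h := Real.rpow_le_rpow_of_exponent_le (one_le_bigP D) (show (0.504 : ℝ) ≤ 1 by norm_num)
  rwa [Real.rpow_one] at h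

open scoped Classical in
/-- **(7.15) from the `l ∉ 𝔌(Rh)` truncation and the Cauchy step alone**: `Step7bTruncI c′` and the two
bounds of `§7.u041` give `Eq715 c′` — "This yields (7.15)" (tex L2058). Bookkeeping only:
`|𝔰| ≤ |𝔰*| + ε`, the number of pairs `(r, θ)` is `≤ (2R+1)² ≤ 9R² ≤ 9P²`, `ε = exp(−c𝓛¹⁰) ≤ D^{−c}`
for `c ≤` the `c` of the truncation, and `D^{−c}` is monotone in `c`.
[cite: Zhang2022LandauSiegel, §7 p.39, tex L2058] -/
theorem eq715_of_truncI_u041 (c' : ℝ) (hI : Step7bTruncI c') (h41 : Step7u041 c') : Eq715 c' := by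
  intro B
  obtain ⟨h41a, h41b⟩ := h41
  obtain ⟨k, C₁, hA⟩ := h41a B
  obtain ⟨c, hc, C₂, hB⟩ := h41b k
  obtain ⟨cI, hcI, hIB⟩ := hI B
  obtain ⟨D₀, hD₀⟩ := (hA.and hB).and hIB
  refine ⟨min c cI, lt_min hc hcI, max C₁ 0 * C₂ + 9, max D₀ 3, ?_⟩
  intro D _ χ hD hq hp hAx a₁ ha₁ d h R hd hh hR
  have hD' : D₀ ≤ D := le_trans (le_max_left _ _) hD
  have hD3 : 3 ≤ D := le_trans (le_max_right _ _) hD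
  obtain ⟨⟨hA', hB'⟩, hI'⟩ := hD₀ D χ hD' hq hp
  have h1 := hA' hAx a₁ ha₁ d h R hd hh hR
  have h2 := hB' d h R hd hh hR
  have h3 := hI' hAx a₁ ha₁ d h R hd hh hR
  obtain ⟨hdh, hRD, hRP⟩ := hR
  -- the quantities involved
  set τ := MeanSquareMajorant.tau 5 d with hτ
  set P := Skeleton.bigP D with hPdef
  set ℓ := Skeleton.ell D with hℓ
  set X := R ^ (1 / 2 : ℝ) * P ^ (3 / 2 : ℝ) + R ^ (-(1 / 2 : ℝ)) * P ^ 2 with hX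
  set E := Real.exp (-cI * ℓ ^ 10) with hE
  set Sst := ∑ r ∈ dyadic R, ∑ θ : DirichletCharacter ℂ r,
      (if θ.IsPrimitive then ‖frakSstar c' D a₁ R r h d θ‖ else 0) with hSst
  set S := ∑ r ∈ dyadic R, ∑ θ : DirichletCharacter ℂ r,
      (if θ.IsPrimitive then ‖frakS c' D a₁ r h d θ‖ else 0) with hS
  set Ncnt := ∑ r ∈ dyadic R, ∑ θ : DirichletCharacter ℂ r,
      (if θ.IsPrimitive then (1 : ℝ) else 0) with hN
  -- elementary positivity
  have hτ1 : 1 ≤ τ := one_le_tau_five hd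
  have hh1 : (1 : ℝ) ≤ h := by exact_mod_cast hh
  have hP1 : 1 ≤ P := one_le_bigP D
  have hℓ1 : 1 ≤ ℓ := one_le_ell hD3
  have hD1 : (1 : ℝ) ≤ D := by exact_mod_cast (show 1 ≤ D by omega)
  have hDpos : (0 : ℝ) < D := by linarith
  have hR1 : 1 ≤ R := le_trans (by exact_mod_cast (show 1 ≤ D by omega)) hRD
  have hR0 : 0 < R := by linarith
  have hX0 : 0 ≤ X := by positivity
  have hE0 : 0 ≤ E := Real.exp_nonneg _
  have hSst0 : 0 ≤ Sst :=
    Finset.sum_nonneg fun _ _ => Finset.sum_nonneg fun _ _ => by split_ifs <;> positivity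
  have hN0 : 0 ≤ Ncnt :=
    Finset.sum_nonneg fun _ _ => Finset.sum_nonneg fun _ _ => by split_ifs <;> norm_num
  have hRpow0 : 0 ≤ R ^ (-(3 / 2 : ℝ)) := Real.rpow_nonneg hR0.le _
  have hRpow1 : R ^ (-(3 / 2 : ℝ)) ≤ 1 := Real.rpow_le_one_of_one_le_of_nonpos hR1 (by norm_num)
  have hY0 : 0 ≤ τ * (h : ℝ) * P ^ 2 := by positivity
  -- (1) `S ≤ S* + E · N`
  have hS1 : S ≤ Sst + E * Ncnt := by
    rw [hS, hSst, hN, Finset.mul_sum, ← Finset.sum_add_distrib]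
    refine Finset.sum_le_sum fun r hr => ?_
    rw [Finset.mul_sum, ← Finset.sum_add_distrib]
    refine Finset.sum_le_sum fun θ _ => ?_
    split_ifs with hθ
    · have hd3 := h3 r hr θ hθ
      have := norm_le_insert' (frakS c' D a₁ r h d θ) (frakSstar c' D a₁ R r h d θ)
      rw [mul_one]
      linarith
    · simp
  -- (2) the `𝔰*` part: `R^{-3/2} S* ≤ max(C₁,0) · C₂ · τ h P² D^{-c}`
  have h1' : R ^ (-(3 / 2 : ℝ)) * Sst ≤ max C₁ 0 * (τ * (h : ℝ) * ℓ ^ k * X) := by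
    calc R ^ (-(3 / 2 : ℝ)) * Sst ≤ C₁ * τ * (h : ℝ) * ℓ ^ k * X := h1
      _ = C₁ * (τ * (h : ℝ) * ℓ ^ k * X) := by ring
      _ ≤ max C₁ 0 * (τ * (h : ℝ) * ℓ ^ k * X) :=
          mul_le_mul_of_nonneg_right (le_max_left _ _) (by positivity)
  have h2' : τ * (h : ℝ) * ℓ ^ k * X ≤ C₂ * (τ * (h : ℝ) * P ^ 2 * (D : ℝ) ^ (-c)) := by
    calc τ * (h : ℝ) * ℓ ^ k * X ≤ C₂ * τ * (h : ℝ) * P ^ 2 * (D : ℝ) ^ (-c) := h2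
      _ = C₂ * (τ * (h : ℝ) * P ^ 2 * (D : ℝ) ^ (-c)) := by ring
  have hC₂ : 0 ≤ C₂ := by
    have hpos : 0 < τ * (h : ℝ) * P ^ 2 * (D : ℝ) ^ (-c) := by positivity
    have : 0 * (τ * (h : ℝ) * P ^ 2 * (D : ℝ) ^ (-c)) ≤ C₂ * (τ * (h : ℝ) * P ^ 2 * (D : ℝ) ^ (-c)) := by
      rw [zero_mul]; exact le_trans (by positivity) h2'
    exact le_of_mul_le_mul_right this hpos
  -- (3) `D^{-c} ≤ D^{-min(c, c_I)}` and `E ≤ D^{-min(c, c_I)}`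
  have hDc : (D : ℝ) ^ (-c) ≤ (D : ℝ) ^ (-min c cI) :=
    Real.rpow_le_rpow_of_exponent_le hD1 (neg_le_neg (min_le_left c cI))
  have hEm : E ≤ (D : ℝ) ^ (-min c cI) := by
    rw [hE, Real.rpow_def_of_pos hDpos, ← hℓ.symm.trans rfl]
    rw [show Real.log (D : ℝ) = ℓ from by rw [hℓ, Skeleton.ell]]
    apply Real.exp_le_exp.mpr
    have hm : min c cI ≤ cI := min_le_right c cI
    have hm0 : 0 ≤ min c cI := le_of_lt (lt_min hc hcI)
    have hℓ10 : ℓ ≤ ℓ ^ 10 := le_self_pow₀ hℓ1 (by norm_num)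
    nlinarith [mul_le_mul hm hℓ10 (by linarith) hcI.le]
  -- (4) the `ε` part: `R^{-3/2} · E · N ≤ 9 τ h P² D^{-min(c, c_I)}`
  have hNle : Ncnt ≤ 9 * R ^ 2 := by
    calc Ncnt ≤ (2 * R + 1) ^ 2 := sum_dyadic_card_le hR1
      _ ≤ (3 * R) ^ 2 := by gcongr; linarith
      _ = 9 * R ^ 2 := by ring
  have hRP1 : R ≤ P := by
    have hP1pos : 0 ≤ Skeleton.P1 D := by rw [Skeleton.P1]; positivity
    have hdh1 : (1 : ℝ) ≤ ((d * h : ℕ) : ℝ) := by exact_mod_cast Nat.one_le_iff_ne_zero.mpr (Nat.mul_ne_zero hd.ne' hh.ne')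
    calc R ≤ Skeleton.P1 D / ((d * h : ℕ) : ℝ) := hRP.le
      _ ≤ Skeleton.P1 D := div_le_self hP1pos hdh1
      _ ≤ P := P1_le_bigP D
  have h4 : R ^ (-(3 / 2 : ℝ)) * (E * Ncnt) ≤ 9 * (τ * (h : ℝ) * P ^ 2 * (D : ℝ) ^ (-min c cI)) := by
    have hR2 : R ^ 2 ≤ P ^ 2 := by gcongr
    calc R ^ (-(3 / 2 : ℝ)) * (E * Ncnt) ≤ 1 * (E * (9 * R ^ 2)) := by
          apply mul_le_mul hRpow1 (mul_le_mul_of_nonneg_left hNle hE0) (by positivity) zero_le_one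
      _ = 9 * (E * R ^ 2) := by ring
      _ ≤ 9 * ((D : ℝ) ^ (-min c cI) * P ^ 2) := by gcongr
      _ = 9 * (1 * 1 * P ^ 2 * (D : ℝ) ^ (-min c cI)) := by ring
      _ ≤ 9 * (τ * (h : ℝ) * P ^ 2 * (D : ℝ) ^ (-min c cI)) := by gcongr
  -- (5) assemble
  have hmain : R ^ (-(3 / 2 : ℝ)) * Sst ≤
      max C₁ 0 * C₂ * (τ * (h : ℝ) * P ^ 2 * (D : ℝ) ^ (-min c cI)) := by
    calc R ^ (-(3 / 2 : ℝ)) * Sst ≤ max C₁ 0 * (τ * (h : ℝ) * ℓ ^ k * X) := h1'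
      _ ≤ max C₁ 0 * (C₂ * (τ * (h : ℝ) * P ^ 2 * (D : ℝ) ^ (-c))) :=
          mul_le_mul_of_nonneg_left h2' (le_max_right _ _)
      _ ≤ max C₁ 0 * (C₂ * (τ * (h : ℝ) * P ^ 2 * (D : ℝ) ^ (-min c cI))) := by
          apply mul_le_mul_of_nonneg_left _ (le_max_right _ _)
          exact mul_le_mul_of_nonneg_left (mul_le_mul_of_nonneg_left hDc hY0) hC₂
      _ = max C₁ 0 * C₂ * (τ * (h : ℝ) * P ^ 2 * (D : ℝ) ^ (-min c cI)) := by ring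
  calc R ^ (-(3 / 2 : ℝ)) * S ≤ R ^ (-(3 / 2 : ℝ)) * (Sst + E * Ncnt) :=
        mul_le_mul_of_nonneg_left hS1 hRpow0
    _ = R ^ (-(3 / 2 : ℝ)) * Sst + R ^ (-(3 / 2 : ℝ)) * (E * Ncnt) := by ring
    _ ≤ max C₁ 0 * C₂ * (τ * (h : ℝ) * P ^ 2 * (D : ℝ) ^ (-min c cI)) +
          9 * (τ * (h : ℝ) * P ^ 2 * (D : ℝ) ^ (-min c cI)) := add_le_add hmain h4
    _ = (max C₁ 0 * C₂ + 9) * τ * (h : ℝ) * P ^ 2 * (D : ℝ) ^ (-min c cI) := by ring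

/-- **The edge `Ded715` holds**: the `l ∉ 𝔌(Rh)` truncation (`Step7bTruncI`) and `§7.u041` give
(7.15) (`eq715_of_truncI_u041`); `§7.u038`–`u040` are not needed for the edge as typed (`§7.u041`
already states their consequence). [cite: Zhang2022LandauSiegel, §7 p.39, tex L2058] -/
theorem ded715_holds (c' : ℝ) : Ded715 c' :=
  fun hI _ _ _ h41 => eq715_of_truncI_u041 c' hI h41

open scoped Classical in
/-- **`§7.u040` holds**: `Σ_{R≤r<2R} Σ*_{θ mod r} |Σ_{p∼P} θ̄(p)p^s|² ≤ 486(R² + P)P³` for `σ = 1`,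
`R ≥ 1`, `D ≥ 3` — the tree's large sieve for primitive characters over an arbitrary set of
moduli `⊆ [1, Q]` (`Zhang2022.largeSieve_meanValue`, `Q = ⌈2R⌉`, length `N = ⌈P(1+𝓛⁻⁶⁸)⌉ ≤ 3P`,
coefficients `p^s 1_{p∼P}` of size `p ≤ N`), after re-indexing `θ ↦ θ̄ = θ⁻¹` (primitivity is
preserved, `DirichletCharacter.conductor_inv`). [cite: Zhang2022LandauSiegel, §7 p.39, tex L2051] -/
theorem step7u040_holds : Step7u040 := by
  refine ⟨486, 3, fun D _ χ hD _ _ _ R hR s hs => ?_⟩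
  have hD3 : 3 ≤ D := hD
  set P := Skeleton.bigP D with hP
  have hP1 : 1 ≤ P := one_le_bigP D
  have hℓ1 : 1 ≤ Skeleton.ell D := one_le_ell hD3
  have hR0 : 0 ≤ R := by linarith
  set N : ℕ := ⌈Skeleton.bigP D * (1 + (Skeleton.ell D ^ 68)⁻¹)⌉₊ with hN
  set Q : ℕ := ⌈2 * R⌉₊ with hQ
  set a : ℕ → ℂ := fun n => if n ∈ Skeleton.primeWindow D then (n : ℂ) ^ s else 0 with ha
  -- the window sits inside `(0, N]`, the dyadic block inside `[1, Q]`
  have hW : Skeleton.primeWindow D ⊆ Finset.Ioc 0 N := by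
    intro p hp
    have hp' := Finset.mem_Ioo.mp (Finset.mem_filter.mp hp).1
    exact Finset.mem_Ioc.mpr ⟨by omega, hp'.2.le⟩
  have hM : dyadic R ⊆ Finset.Icc 1 Q := by
    intro r hr
    obtain ⟨hRr, _⟩ := mem_dyadic hr
    have h1 : (1 : ℝ) ≤ r := le_trans hR hRr
    have hrQ : r < Q := Finset.mem_range.mp (Finset.mem_filter.mp hr).1
    exact Finset.mem_Icc.mpr ⟨by exact_mod_cast h1, hrQ.le⟩
  have hLS := largeSieve_meanValue (dyadic R) N Q hM a
  -- the left side is the large-sieve form after `θ ↦ θ⁻¹`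
  have hlhs : (∑ r ∈ dyadic R, ∑ θ : DirichletCharacter ℂ r,
        (if θ.IsPrimitive then ‖pPoly D r θ s‖ ^ 2 else 0)) =
      ∑ r ∈ dyadic R, ∑ θ : DirichletCharacter ℂ r with θ.IsPrimitive,
        ‖∑ n ∈ Finset.Ioc 0 N, a n * θ n‖ ^ 2 := by
    refine Finset.sum_congr rfl fun r _ => ?_
    rw [Finset.sum_filter,
      ← Equiv.sum_comp (Equiv.inv (DirichletCharacter ℂ r))
        (fun θ : DirichletCharacter ℂ r => if θ.IsPrimitive then ‖pPoly D r θ s‖ ^ 2 else 0)]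
    refine Finset.sum_congr rfl fun θ _ => ?_
    have hprim : (θ⁻¹).IsPrimitive ↔ θ.IsPrimitive := by
      rw [DirichletCharacter.isPrimitive_def, DirichletCharacter.isPrimitive_def,
        DirichletCharacter.conductor_inv]
    simp only [Equiv.inv_apply, hprim]
    split_ifs with hθ
    · congr 2
      rw [pPoly, inv_inv]
      have hsum : ∑ n ∈ Finset.Ioc 0 N, a n * θ n =
          ∑ n ∈ Finset.Ioc 0 N,
            (if n ∈ Skeleton.primeWindow D then (n : ℂ) ^ s * θ n else 0) := by
        refine Finset.sum_congr rfl fun n _ => ?_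
        simp only [ha]
        split_ifs <;> simp
      rw [hsum, Finset.sum_ite_mem, Finset.inter_eq_right.mpr hW]
      exact Finset.sum_congr rfl fun p _ => mul_comm _ _
    · rfl
  -- sizes
  have hNle : (N : ℝ) ≤ 3 * P := by
    have h68 : (Skeleton.ell D ^ 68)⁻¹ ≤ 1 := inv_le_one_of_one_le₀ (one_le_pow₀ hℓ1)
    have hx0 : 0 ≤ P * (1 + (Skeleton.ell D ^ 68)⁻¹) := by positivity
    calc (N : ℝ) ≤ P * (1 + (Skeleton.ell D ^ 68)⁻¹) + 1 := (Nat.ceil_lt_add_one hx0).le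
      _ ≤ P * (1 + 1) + P := by gcongr
      _ = 3 * P := by ring
  have hQle : (Q : ℝ) ≤ 3 * R := by
    calc (Q : ℝ) ≤ 2 * R + 1 := (Nat.ceil_lt_add_one (by linarith)).le
      _ ≤ 3 * R := by linarith
  have hQsq : (Q : ℝ) ^ 2 ≤ (3 * R) ^ 2 := by gcongr
  have hsuma : ∑ n ∈ Finset.Ioc 0 N, ‖a n‖ ^ 2 ≤ (N : ℝ) ^ 3 := by
    calc ∑ n ∈ Finset.Ioc 0 N, ‖a n‖ ^ 2 ≤ ∑ _n ∈ Finset.Ioc 0 N, (N : ℝ) ^ 2 := by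
          refine Finset.sum_le_sum fun n hn => ?_
          have hn' := Finset.mem_Ioc.mp hn
          simp only [ha]
          split_ifs
          · rw [Complex.norm_natCast_cpow_of_pos hn'.1, hs, Real.rpow_one]
            gcongr
            exact_mod_cast hn'.2
          · simp
      _ = (N : ℝ) * (N : ℝ) ^ 2 := by
          rw [Finset.sum_const, Nat.card_Ioc, nsmul_eq_mul, Nat.sub_zero]
      _ = (N : ℝ) ^ 3 := by ring
  have hfac : (N : ℝ) + 1 + 2 * (Q : ℝ) ^ 2 ≤ 18 * (R ^ 2 + P) := by nlinarith
  have hN3 : (N : ℝ) ^ 3 ≤ 27 * P ^ 3 := by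
    calc (N : ℝ) ^ 3 ≤ (3 * P) ^ 3 := by gcongr
      _ = 27 * P ^ 3 := by ring
  calc (∑ r ∈ dyadic R, ∑ θ : DirichletCharacter ℂ r,
        (if θ.IsPrimitive then ‖pPoly D r θ s‖ ^ 2 else 0))
      = ∑ r ∈ dyadic R, ∑ θ : DirichletCharacter ℂ r with θ.IsPrimitive,
          ‖∑ n ∈ Finset.Ioc 0 N, a n * θ n‖ ^ 2 := hlhs
    _ ≤ ((N : ℝ) + 1 + 2 * (Q : ℝ) ^ 2) * ∑ n ∈ Finset.Ioc 0 N, ‖a n‖ ^ 2 := hLS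
    _ ≤ (18 * (R ^ 2 + P)) * (27 * P ^ 3) :=
        mul_le_mul hfac (hsuma.trans hN3) (Finset.sum_nonneg fun _ _ => by positivity)
          (by positivity)
    _ = 486 * (R ^ 2 + P) * P ^ 3 := by ring


/-! ## The interface stubs agree with the owner's landed declarations (slice L2-t3) -/

/-- `κ ∗ a₁` as this slice writes it (`MeanSquareMajorant.conv`) is the owner's `kappaConv`
(`LSeries.convolution`): the tree's `MeanSquareMajorant.conv_eq_convolution` — the "conv seam" of
sz-ref-c's cross-file audit, one lemma for both consumers. [cite: Zhang2022LandauSiegel, §7 p.34, tex L1869] -/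
theorem conv_eq_kappaConv (c' : ℝ) (D : ℕ) (a₁ : ℕ → ℂ) :
    MeanSquareMajorant.conv (Skeleton.kappaZ c' D) a₁ = Section7bStatements.kappaConv c' D a₁ := by
  unfold Section7bStatements.kappaConv
  exact MeanSquareMajorant.conv_eq_convolution _ _

open scoped Classical in
/-- The `θ`-sum of the stub equals the owner's `nonprincTwist` at every modulus `k + 1`
(`gaussBar (k+1) θ = GammaFactor.tau θ⁻¹`; filtered sum = sum with indicator).
[cite: Zhang2022LandauSiegel, §7 p.36, tex L1957] -/
theorem theta_sum_eq_nonprincTwist (l p k : ℕ) :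
    (∑ θ : DirichletCharacter ℂ (k + 1),
        if θ ≠ 1 then gaussBar (k + 1) θ * θ (l : ZMod (k + 1)) * θ⁻¹ (-(p : ZMod (k + 1)))
        else 0) =
      Section7bStatements.nonprincTwist l p (k + 1) := by
  rw [Section7bStatements.nonprincTwist, Finset.sum_filter]
  refine Finset.sum_congr rfl fun θ _ => ?_
  by_cases hθ : θ = 1
  · simp [hθ]
  · rw [if_pos hθ, if_pos hθ, gaussBar, dif_neg (Nat.succ_ne_zero k)]

/-- **TODO-merge discharged**: the stub `Iface.frakT12` IS the owner's `𝔗₁₂(p)`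
(`Section7bStatements.frakT12`, slice L2-t3, landed p412015): same finite ranges, same series,
`κ ∗ a₁` via `conv_eq_kappaConv`, the `θ`-sum via `theta_sum_eq_nonprincTwist` (moduli `k ≥ 1`).
[cite: Zhang2022LandauSiegel, §7 p.37, tex L1968] -/
theorem Iface.frakT12_eq (c' : ℝ) (D p : ℕ) (a₁ a₂ : ℕ → ℂ) :
    Iface.frakT12 c' D p a₁ a₂ = Section7bStatements.frakT12 c' D p a₁ a₂ := by
  unfold Iface.frakT12 Section7bStatements.frakT12
  rw [← conv_eq_kappaConv]
  refine Finset.sum_congr rfl fun d _ => ?_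
  refine congrArg (HMul.hMul (1 / (d : ℂ))) ?_
  refine tsum_congr fun l => Finset.sum_congr rfl fun k hk => ?_
  have hk1 : 1 ≤ k := (Finset.mem_Ico.mp (Finset.mem_filter.mp hk).1).1
  obtain ⟨k', rfl⟩ : ∃ k', k = k' + 1 := ⟨k - 1, by omega⟩
  rw [← theta_sum_eq_nonprincTwist l p k']
  congr 3
  funext θ
  split_ifs <;> rfl

/-- **TODO-merge discharged**: the stub `Iface.Eq711` is EQUIVALENT to the owner's (7.11)
(`Section7bStatements.Eq711`), by `Iface.frakT12_eq`. [cite: Zhang2022LandauSiegel, §7 (7.11) p.37, tex L1980] -/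
theorem Iface.eq711_iff (c' : ℝ) : Iface.Eq711 c' ↔ Section7bStatements.Eq711 c' := by
  unfold Iface.Eq711 Section7bStatements.Eq711
  simp only [Iface.frakT12_eq]

/-- The deduction node of this slice, restated with the OWNER's (7.11) as conclusion: the chain
`(7.12) → … → (7.15) → (7.11)` composes with `Section7bStatements.DedProp71red` (the reduction
"(7.6), (7.9), (7.10), (7.11) ⇒ Prop 7.1") without passing through the stub.
[cite: Zhang2022LandauSiegel, §7 pp.37–39, tex L1984–L2058] -/
theorem dedProp71b_iff_owner (c' : ℝ) :
    DedProp71b c' ↔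
      (Eq712 c' → Step7u031tau → Step7u031 c' → Eq713 c' → Step7bTruncP2 c' → Eq714 c' →
        Step7u033 c' → Step7u034 c' → Step7bSmallR c' → Eq715 c' → Section7bStatements.Eq711 c') := by
  unfold DedProp71b
  rw [Iface.eq711_iff]

end Literature.NumberTheory.LFunctions.Zhang2022.Section7cStatements
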